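import Summits.Ventures.PercRepro.SixThreeProfileB

/-!
# PercRepro — classifying a plane by its longest line (p2, gen 6)

mine-2 `MINE2-RLS.md` §19.7 Step 4 / §19.9: a plane `G` with `g ≥ 4` points and longest line through `m₁` points is
* GENERAL when `m₁ ≤ g − 3` (every profile entry `m` has `m + 3 ≤ g`: p3's `table_general` hypotheses);
* LINE + POINT when `m₁ = g − 1` — then the profile is exactly `{g − 1}`;
* TWO LINES when `m₁ = g − 2` — the two points off the long line span a line meeting it in at most one point, and
  the profile is `{g − 2}` (two disjoint lines, the second of size `2`) or `{g − 2, 3}` (two lines meeting).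
`prof_classify` is the exhaustive statement; the profile identities let p3's special-family rows be applied verbatim.
-/

namespace PercRepro

namespace SixThree

open Finset ThmH

variable {α : Type*} [DecidableEq α] {M : Matroid α} [M.Finite]

/-- The lines of `M|G` with at least `3` points (the index set of the profile). -/
noncomputable def bigLines (M : Matroid α) [M.Finite] (G : Finset α) : Finset (Finset α) :=
  (linesOf M G).filter (fun L => 3 ≤ (L ∩ G).card)

/-- `prof = (bigLines).val.map (|· ∩ G|)`. -/
theorem prof_eq (G : Finset α) : prof M G = (bigLines M G).val.map (fun L => (L ∩ G).card) := rfl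

/-- Two distinct lines of `M|G` share at most one point of `G`. -/
theorem card_inter_inter_le_one (hs : Simple M) {G L L' : Finset α} (hL : L ∈ linesOf M G) (hL' : L' ∈ linesOf M G)
    (hne : L ≠ L') : (L ∩ L' ∩ G).card ≤ 1 := by
  by_contra h
  push Not at h
  obtain ⟨u, hu, v, hv, huv⟩ := Finset.one_lt_card.1 h
  simp only [Finset.mem_inter] at hu hv
  exact hne (lines_eq_of_two_mem hs (Finset.mem_filter.1 hL).1 (Finset.mem_filter.1 hL').1 hu.1.1 hv.1.1 hu.1.2
    hv.1.2 huv)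

/-- A line other than `L₀` meets `G` in at most `1 + |G ∖ L₀|` points. -/
theorem card_inter_le_of_ne (hs : Simple M) {G L₀ L : Finset α} (hL₀ : L₀ ∈ linesOf M G) (hL : L ∈ linesOf M G)
    (hne : L ≠ L₀) : (L ∩ G).card ≤ 1 + (G \ L₀).card := by
  have h1 := card_inter_inter_le_one hs hL hL₀ hne
  have hsub : L ∩ G ⊆ (L ∩ L₀ ∩ G) ∪ (G \ L₀) := by
    intro y hy
    rw [Finset.mem_inter] at hy
    rw [Finset.mem_union, Finset.mem_inter, Finset.mem_inter, Finset.mem_sdiff]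
    by_cases hyL₀ : y ∈ L₀
    · exact Or.inl ⟨⟨hy.1, hyL₀⟩, hy.2⟩
    · exact Or.inr ⟨hy.2, hyL₀⟩
  calc (L ∩ G).card ≤ ((L ∩ L₀ ∩ G) ∪ (G \ L₀)).card := Finset.card_le_card hsub
    _ ≤ (L ∩ L₀ ∩ G).card + (G \ L₀).card := Finset.card_union_le _ _
    _ ≤ 1 + (G \ L₀).card := by omega

/-- **Line + point**: a line through `g − 1` points of `G` (`g ≥ 4`) is the only big line: `prof = {g − 1}`. -/
theorem prof_of_line_point (hs : Simple M) {G L₀ : Finset α} (hg4 : 4 ≤ G.card)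
    (hL₀ : L₀ ∈ linesOf M G) (hk : (L₀ ∩ G).card = G.card - 1) : prof M G = {G.card - 1} := by
  classical
  have hoff : (G \ L₀).card = 1 := by
    have h := Finset.card_sdiff_add_card_inter G L₀
    rw [Finset.inter_comm, hk] at h
    omega
  have hbig : bigLines M G = {L₀} := by
    ext L
    unfold bigLines
    rw [Finset.mem_filter, Finset.mem_singleton]
    constructor
    · rintro ⟨hL, h3⟩
      by_contra hne
      have := card_inter_le_of_ne hs hL₀ hL hne
      omega
    · rintro rfl
      exact ⟨hL₀, by omega⟩
  rw [prof_eq, hbig]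
  simp [hk]

/-- **Two lines**: a line through `g − 2` points of `G` (`g ≥ 5`) leaves two points `a, a′`; every other big line is the
line through `a, a′` with one point of `L₀`: `prof = {g − 2}` or `prof = {g − 2, 3}`. -/
theorem prof_of_two_lines (hs : Simple M) {G L₀ : Finset α} (hG : G ∈ planes M) (hg5 : 5 ≤ G.card)
    (hL₀ : L₀ ∈ linesOf M G) (hk : (L₀ ∩ G).card = G.card - 2) :
    prof M G = {G.card - 2} ∨ prof M G = {G.card - 2, 3} := by
  classical
  have hGg : G ⊆ gr M := (mem_planes.1 hG).1
  have hoff : (G \ L₀).card = 2 := by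
    have h := Finset.card_sdiff_add_card_inter G L₀
    rw [Finset.inter_comm, hk] at h
    omega
  -- every other big line has exactly `3` points of `G` and contains `G ∖ L₀`
  have hother : ∀ L ∈ bigLines M G, L ≠ L₀ → (L ∩ G).card = 3 ∧ G \ L₀ ⊆ L := by
    intro L hL hne
    unfold bigLines at hL
    rw [Finset.mem_filter] at hL
    have hle := card_inter_le_of_ne hs hL₀ hL.1 hne
    refine ⟨by omega, ?_⟩
    by_contra hnot
    rw [Finset.not_subset] at hnot
    obtain ⟨y, hyG, hyL⟩ := hnot
    have h1 := card_inter_inter_le_one hs hL.1 hL₀ hne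
    have hsub : L ∩ G ⊆ (L ∩ L₀ ∩ G) ∪ ((G \ L₀).erase y) := by
      intro z hz
      rw [Finset.mem_inter] at hz
      rw [Finset.mem_union, Finset.mem_inter, Finset.mem_inter, Finset.mem_erase, Finset.mem_sdiff]
      by_cases hzL₀ : z ∈ L₀
      · exact Or.inl ⟨⟨hz.1, hzL₀⟩, hz.2⟩
      · refine Or.inr ⟨?_, hz.2, hzL₀⟩
        rintro rfl
        exact hyL hz.1
    have := Finset.card_le_card hsub
    have h2 := Finset.card_union_le (L ∩ L₀ ∩ G) ((G \ L₀).erase y)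
    have h3 := Finset.card_erase_of_mem hyG
    omega
  -- at most one other big line (two would share the two off-points)
  have hone : ((bigLines M G).erase L₀).card ≤ 1 := by
    rw [Finset.card_le_one]
    intro L hL L' hL'
    rw [Finset.mem_erase] at hL hL'
    obtain ⟨-, hsubL⟩ := hother L hL.2 hL.1
    obtain ⟨-, hsubL'⟩ := hother L' hL'.2 hL'.1
    obtain ⟨u, hu, v, hv, huv⟩ := Finset.one_lt_card.1 (show 1 < (G \ L₀).card by omega)
    have hLl : L ∈ linesOf M G := (Finset.mem_filter.1 hL.2).1
    have hL'l : L' ∈ linesOf M G := (Finset.mem_filter.1 hL'.2).1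
    exact lines_eq_of_two_mem hs (Finset.mem_filter.1 hLl).1 (Finset.mem_filter.1 hL'l).1 (hsubL hu) (hsubL hv)
      (hsubL' hu) (hsubL' hv) huv
  have hL₀big : L₀ ∈ bigLines M G := by
    unfold bigLines; rw [Finset.mem_filter]; exact ⟨hL₀, by omega⟩
  rcases Nat.eq_zero_or_pos ((bigLines M G).erase L₀).card with h0 | hpos
  · left
    have hbig : bigLines M G = {L₀} := by
      rw [Finset.card_eq_zero] at h0
      have := Finset.insert_erase hL₀big
      rw [h0, Finset.insert_empty] at this
      exact this.symm
    rw [prof_eq, hbig]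
    simp [hk]
  · right
    obtain ⟨L₁, hL₁⟩ := Finset.card_eq_one.1 (le_antisymm hone hpos)
    have hbig : bigLines M G = {L₀, L₁} := by
      have := Finset.insert_erase hL₀big
      rw [hL₁] at this
      rw [← this]
    have hL₁mem : L₁ ∈ (bigLines M G).erase L₀ := by rw [hL₁]; exact Finset.mem_singleton_self _
    rw [Finset.mem_erase] at hL₁mem
    obtain ⟨h3, -⟩ := hother L₁ hL₁mem.2 hL₁mem.1
    rw [prof_eq, hbig]
    have hne : L₀ ≠ L₁ := Ne.symm hL₁mem.1
    simp [Finset.insert_val, hne, hk, h3]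

/-- **Classification** (`g ≥ 4`): general (every big line has `≤ g − 3` points), or line + point (`prof = {g − 1}`),
or two lines (`prof = {g − 2}` or `{g − 2, 3}`, `g ≥ 5`). -/
theorem prof_classify (hs : Simple M) {G : Finset α} (hG : G ∈ planes M) (hg4 : 4 ≤ G.card) :
    (∀ m ∈ prof M G, m + 3 ≤ G.card) ∨ prof M G = {G.card - 1} ∨
      (5 ≤ G.card ∧ (prof M G = {G.card - 2} ∨ prof M G = {G.card - 2, 3})) := by
  classical
  by_cases hgen : ∀ m ∈ prof M G, m + 3 ≤ G.card
  · exact Or.inl hgen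
  · right
    push Not at hgen
    obtain ⟨m, hm, hmg⟩ := hgen
    have hb := prof_mem_bounds hG hm
    rw [prof_eq, Multiset.mem_map] at hm
    obtain ⟨L₀, hL₀, rfl⟩ := hm
    rw [Finset.mem_val] at hL₀
    have hL₀' : L₀ ∈ linesOf M G := (Finset.mem_filter.1 hL₀).1
    rcases (show (L₀ ∩ G).card = G.card - 1 ∨ (L₀ ∩ G).card = G.card - 2 by omega) with h1 | h2
    · exact Or.inl (prof_of_line_point hs hg4 hL₀' h1)
    · have hg5 : 5 ≤ G.card := by
        have := (Finset.mem_filter.1 hL₀).2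
        omega
      exact Or.inr ⟨hg5, prof_of_two_lines hs hG hg5 hL₀' h2⟩

end SixThree

end PercRepro
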